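import Summits.QuantumFields.BalabanUV.Beta.D1BFx.PackedNSidePair
import Summits.QuantumFields.BalabanUV.Beta.D1BFx.PackedKernelSplit
import Summits.QuantumFields.BalabanUV.Beta.AxialDressingRootedBmDress
import Summits.QuantumFields.BalabanUV.Beta.FP.SymJetBlockRows

/-!
# BetaPertH road «BF-x» — (D) «N-DICT» READ-OUT: the ff blocks of the explicit N families `SN`, `W2NInf` (the N data of junction (J2))

STATUS: [folklore] ∕ [our object] `rfl`-level bookkeeping for the road's (K) identity (BINDER row D1, slot (K)); NOT an estimate of Bałaban's, NOT a
discharge of any root-level binder or of (J2).  Provenance: reconstruction; the manuscript(s) under audit are NOT citable.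

WHAT.  PART 8 `PackedRoadK6cSkeleton` (owner d1-p2) displays the junction (J2) — the (A2-N) TABLE dictionary — whose LEFT side reads the N data ONLY
through two ff-block families: the stencil family `fun κ u => blk (coProjBmAtK ρ (m+1) (SN m a S) κ u) true true` and the table family `ffW 𝒲N∞`,
`𝒲N∞ := W2NInf m a r S₂` after (D) PART II ∕ PART 8-NN.  This file READS THEM OUT in the literal's letters (no N object left on (J2)'s left side):
* §1 block readers through `twistR`, `embFF`, finite sums and `Πᵀ_bm` (all `rfl`∕one-line; `blk_add`∕`blk_wsum` are `FP.SymJetBlockRows`');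
* §2 **`blk_tt_SN`**: `blk (SN m a S κ u) tt = blk (S κ u) tt + tBw₁ (m+1) a κ u`; **`coProjBmAt_add`**; **`blk_tt_coProjBmAtK_SN`**: the (J2) stencil family
  `= Πᵀ_bm (ff S) + Πᵀ_bm (tBw₁ (m+1) a)` entrywise;
* §3 **`blk_tt_W2litInf`**, **`ffW_W2NInf`**: `ffW (W2NInf m a r S₂) μ y ν y′ = (the `colH G₀`-double superposition of the ff blocks of `S₂`) + cofPairInf (m+1) a
  (colH G₀ (m+1) μ y) (colH G₀ (m+1) ν y′)`.
So (J2)'s left side is `¼·TOfLeg (m+1) (Ga (m+1) a) (Πᵀ_bm (ff S) + Πᵀ_bm tBw₁) (2 • (ff-superposition of S₂ + cofPairInf))` — the objects an2's Q-DICT-N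
ruling compares with the END's `SB`, `TB`.
Unit `b2b-balaban-beta-d1-formalise-leaf-03` (gen 24); road owner `b2b-balaban-beta-d1-p2`; (J2) ruling: an2 (INBOX [D1P2-G18-INBOX-3]).
-/

noncomputable section

namespace Summit.QuantumFields.BalabanUV.Beta.D1BFx.PackedNSideReadout

open scoped BigOperators
open Literature.MathematicalPhysics.QuantumFieldTheory.Balaban1983to89
open Literature.MathematicalPhysics.QuantumFieldTheory.Balaban1983to89.Beta
open ExpKernelCalculus (MKer)
open AffineAveraging (Form1 toSite)
open OneStepResolventKernel (Fib wsum)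
open OneStepKernelFamily (KInvStep colH)
open Summit.QuantumFields.BalabanUV.Beta.AxialDressingRooted (coDressKBmAt coProjBmAt coProjBmAtK coProjBmAtK_eval)
open Summit.QuantumFields.BalabanUV.Beta.D1BFx.PackedKernelSplit (blk blk_tt ffW ffW_apply)
open Summit.QuantumFields.BalabanUV.Beta.FP.SymJetBlockRows (blk_add)
open Summit.QuantumFields.BalabanUV.Beta.D1BFx.PackedSortedBridges (embFF twistR twistR_inl embFF_inl_inl)
open Summit.QuantumFields.BalabanUV.Beta.D1BFx.TorusWeightWordTwisted (tBw₁)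
open Summit.QuantumFields.BalabanUV.Beta.D1BFx.PackedNSideDictionary (SN SN_apply)
open Summit.QuantumFields.BalabanUV.Beta.D1BFx.PackedCoframePairLimit (cofPairInf)
open Summit.QuantumFields.BalabanUV.Beta.D1BFx.PackedNSidePair (W2lit W2litInf W2N W2NInf)

/-! ## §1 Block readers through the bridges -/

section Readers

variable {D d : ℕ} {F : Type*}

/-- [our object] The ff block ignores the sign twist of the multiplier columns. -/
theorem blk_tt_twistR (K : MKer D (Fib d)) : blk (twistR K) true true = blk K true true := by
  funext x z a b
  rw [blk_tt, blk_tt, twistR_inl]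

/-- [our object] The ff block of an ff-embedded kernel is the kernel. -/
theorem blk_tt_embFF (K : MKer D (Fin (d + 1))) : blk (embFF K) true true = K := by
  funext x z a b
  rw [blk_tt, embFF_inl_inl]

/-- [our object] Block reading commutes with finite sums of kernels. -/
theorem blk_finset_sum {ι : Type*} (s : Finset ι) (K : ι → MKer D (F ⊕ F)) (i j : Bool) :
    blk (∑ k ∈ s, K k) i j = ∑ k ∈ s, blk (K k) i j := by
  funext x z a b
  simp only [blk, Finset.sum_apply]

/-- [our object] Block reading commutes with `Πᵀ_bm` on a bond family (both act entrywise). -/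
theorem blk_coProjBmAtK (ρ : Fin (d + 1) → ℤ) (N : ℕ) (T : Fin (d + 1) → (Fin (d + 1) → ℤ) → MKer (d + 1) (Fib d))
    (κ : Fin (d + 1)) (u : Fin (d + 1) → ℤ) (i j : Bool) :
    blk (coProjBmAtK ρ N T κ u) i j = fun x y a b => coProjBmAt ρ N (fun κ' u' => blk (T κ' u') i j x y a b) κ u := rfl

/-- [folklore] `Πᵀ_bm` is additive (a finite sum of products). -/
theorem coProjBmAt_add (ρ : Fin (d + 1) → ℤ) (N : ℕ) (g h : Form1 (d + 1) ℝ) :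
    coProjBmAt ρ N (g + h) = coProjBmAt ρ N g + coProjBmAt ρ N h := by
  funext α q
  simp only [coProjBmAt, Pi.add_apply, mul_add, Finset.sum_add_distrib]

end Readers

/-! ## §2 The stencil side of (J2): `blk (Πᵀ_bm SN) tt` -/

section Stencil

variable (m : ℕ) (a : ℝ) (S : Fin 4 → (Fin 4 → ℤ) → MKer 4 (Fib 3))

/-- [our object] **THE ff BLOCK OF `SN`**: `blk (SN m a S κ u) tt = blk (S κ u) tt + tBw₁ (m+1) a κ u`. -/
theorem blk_tt_SN (κ : Fin 4) (u : Fin 4 → ℤ) : blk (SN m a S κ u) true true = blk (S κ u) true true + tBw₁ (m + 1) a κ u := by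
  rw [SN_apply, blk_add, blk_tt_twistR, blk_tt_embFF]

/-- [our object] **THE (J2) STENCIL FAMILY READ OUT**: `blk (Πᵀ_bm (SN m a S) κ u) tt = Πᵀ_bm (ff S) κ u + Πᵀ_bm (tBw₁ (m+1) a) κ u` entrywise. -/
theorem blk_tt_coProjBmAtK_SN (ρ : Fin 4 → ℤ) (N : ℕ) :
    (fun κ u => blk (coProjBmAtK ρ N (SN m a S) κ u) true true)
      = fun κ u x y α β => coProjBmAt ρ N (fun κ' u' => blk (S κ' u') true true x y α β) κ u
          + coProjBmAt ρ N (fun κ' u' => tBw₁ (m + 1) a κ' u' x y α β) κ u := by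
  funext κ u x y α β
  rw [blk_coProjBmAtK]
  simp only [blk_tt_SN]
  exact congrFun (congrFun (coProjBmAt_add ρ N _ _) κ) u

end Stencil

/-! ## §3 The table side of (J2): `ffW W2NInf` -/

section Table

variable (m : ℕ) (a : ℝ) (r : Fin (3 + 1) → ℕ) (S₂ : Fin 4 → (Fin 4 → ℤ) → Fin 4 → (Fin 4 → ℤ) → MKer 4 (Fib 3))

/-- [our object] **THE ff BLOCK OF THE LITERAL's LIMIT TABLE**: the same `colH G₀`-double superposition of the ff blocks of `S₂`. -/
theorem blk_tt_W2litInf (μ : Fin 4) (y : Fin 4 → ℤ) (ν : Fin 4) (y' : Fin 4 → ℤ) :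
    blk (W2litInf m r S₂ μ y ν y') true true = fun x z α β => ∑ κ' : Fin 4, ∑ κ'' : Fin 4,
      wsum (colH (coDressKBmAt (toSite r) (m + 1) (KInvStep (d := 3) (m + 1) 0)) (m + 1) μ y κ')
        (fun u => wsum (colH (coDressKBmAt (toSite r) (m + 1) (KInvStep (d := 3) (m + 1) 0)) (m + 1) ν y' κ'')
          (fun u' => blk (S₂ κ' u κ'' u') true true)) x z α β := rfl

/-- [our object] The same for the finite-torus table `W2lit … s`. -/
theorem blk_tt_W2lit (s : ℕ) (μ : Fin 4) (y : Fin 4 → ℤ) (ν : Fin 4) (y' : Fin 4 → ℤ) :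
    blk (W2lit m r S₂ s μ y ν y') true true = fun x z α β => ∑ κ' : Fin 4, ∑ κ'' : Fin 4,
      wsum (colH (coDressKBmAt (toSite r) (m + 1) (KInvStep (d := 3) (m + 1) 0)) (m + 1) μ y κ')
        (fun u => wsum (fun u'' => ∑' t : Fin 4 → ℤ,
          colH (coDressKBmAt (toSite r) (m + 1) (KInvStep (d := 3) (m + 1) 0)) (m + 1) ν y' κ'' (imageShift s u'' t))
          (fun u' => blk (S₂ κ' u κ'' u') true true)) x z α β := rfl

/-- [our object] **THE ff BLOCK OF `W2NInf`**: literal part + the limit co-frame pair table. -/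
theorem blk_tt_W2NInf (μ : Fin 4) (y : Fin 4 → ℤ) (ν : Fin 4) (y' : Fin 4 → ℤ) :
    blk (W2NInf m a r S₂ μ y ν y') true true
      = blk (W2litInf m r S₂ μ y ν y') true true
          + cofPairInf (m + 1) a (colH (coDressKBmAt (toSite r) (m + 1) (KInvStep (d := 3) (m + 1) 0)) (m + 1) μ y)
              (colH (coDressKBmAt (toSite r) (m + 1) (KInvStep (d := 3) (m + 1) 0)) (m + 1) ν y') := by
  rw [W2NInf, blk_add, blk_tt_twistR, blk_tt_embFF]

/-- [our object] The same for the finite-torus family `W2N … s`. -/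
theorem blk_tt_W2N (s : ℕ) (μ : Fin 4) (y : Fin 4 → ℤ) (ν : Fin 4) (y' : Fin 4 → ℤ) :
    blk (W2N m a r S₂ s μ y ν y') true true
      = blk (W2lit m r S₂ s μ y ν y') true true
          + PackedCoframePairLoc.cofPair s (m + 1) a (colH (coDressKBmAt (toSite r) (m + 1) (KInvStep (d := 3) (m + 1) 0)) (m + 1) μ y)
              (colH (coDressKBmAt (toSite r) (m + 1) (KInvStep (d := 3) (m + 1) 0)) (m + 1) ν y') := by
  rw [W2N, blk_add, blk_tt_twistR, blk_tt_embFF]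

/-- [our object] **`ffW (W2NInf m a r S₂)` READ OUT — THE (J2) TABLE FAMILY**: at every pair of base points, the `colH G₀`-double superposition of the
ff blocks of `S₂` plus `cofPairInf (m+1) a (colH G₀ (m+1) μ y) (colH G₀ (m+1) ν y′)`. -/
theorem ffW_W2NInf :
    ffW (W2NInf m a r S₂) = fun μ y ν y' =>
      (fun x z α β => ∑ κ' : Fin 4, ∑ κ'' : Fin 4,
        wsum (colH (coDressKBmAt (toSite r) (m + 1) (KInvStep (d := 3) (m + 1) 0)) (m + 1) μ y κ')
          (fun u => wsum (colH (coDressKBmAt (toSite r) (m + 1) (KInvStep (d := 3) (m + 1) 0)) (m + 1) ν y' κ'')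
            (fun u' => blk (S₂ κ' u κ'' u') true true)) x z α β)
        + cofPairInf (m + 1) a (colH (coDressKBmAt (toSite r) (m + 1) (KInvStep (d := 3) (m + 1) 0)) (m + 1) μ y)
            (colH (coDressKBmAt (toSite r) (m + 1) (KInvStep (d := 3) (m + 1) 0)) (m + 1) ν y') := by
  funext μ y ν y'
  rw [ffW_apply, blk_tt_W2NInf, blk_tt_W2litInf]

end Table

end Summit.QuantumFields.BalabanUV.Beta.D1BFx.PackedNSideReadout

end
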